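import Summits.QuantumFields.YangMills.Theorems.LocalInsertionCombGaugeLadder
import Summits.QuantumFields.YangMills.Theorems.PoincareLipschitzTwoSidedOfConcentrationStep
import Literature.MathematicalPhysics.QuantumFieldTheory.Balaban1983to89.T3DescentFibreTower
import HarnessLib

/-!
# Crux `HistoryTailL` (stmt-QuantumFields-19936), line #13 `local_insertion` — THE COMB GAUGE OF A BOX (existence form)

Cell `ym3-torus` (YM ladder rung R3 = continuum SU(2) Yang–Mills on the three-torus — a RUNG, NOT the Clay problem), width seat
`ym-ust-19936-w3` gen 11, `--supports stmt-QuantumFields-19936 --as helper`.  THEOREMS ONLY, definition-free, ROUTE-INDEPENDENT.  Deterministic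
group algebra over ✓`LocalInsertionCombGaugeLadder`; nothing of `LocalInsertionL` (23607), the stubs, the crux `HistoryTailL` or any summit
statement is proved.

★★`exists_combGauge_dist1_le` — for three directions `μ₀ < μ₁ < μ₂` exhausting `Fin P.d` (`d = 3`), every configuration `U`, base point and `n` with
`n + 1 ≤ N` (no wrap-around): there is a gauge transformation `g` (the complete axial «comb» gauge: `e₀`-, then `e₁`-, then `e₂`-segments from the
base, holonomies as `List.prod`) such that for every bond `⟨x, μ⟩` with endpoint offsets `< n`,
`dist1 ((U^g)⟨x, μ⟩) ≤ Σ_{t<n} [dist1 U(∂⟨P₂+te₂, μ₀, μ₂⟩) + dist1 U(∂⟨P₁+te₁, μ₀, μ₁⟩) + dist1 U(∂⟨P₂+te₂, μ₁, μ₂⟩)]` with the foot points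
`P₁ = base + o₀e₀`, `P₂ = P₁ + o₁e₁` of `x` (`o_k = (x k − base k).val`) — a CONFIGURATION-INDEPENDENT family of `3n` plaquettes with source in
the box (top direction: `U^g = 1`; middle: one ladder; bottom: two ladders).
§2 (cell-level helpers for the consumer `LocalInsertionMedianHeightOneOfMeanPlaquette`, namespace `…LocalInsertion.MedianHeightOne`):
`dir_cases` (the three directions of the `d = 3` families), `iter_blockAvg_one` (`Ū(1) = 1`), `box_fits` (`17L + 1 ≤ 2L^{m+K}` for `K ≥ 3`),
`sqrt_sum_sq_le_sum` (`ℓ² ≤ ℓ¹`), `card_filter_offsets_lt_le` (`≤ 3n³` bonds with source offsets `< n`). [folklore]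
-/

set_option autoImplicit false

open Literature.MathematicalPhysics.QuantumFieldTheory.Balaban1983to89

namespace Summit.QuantumFields.YangMills.Theorems.LocalInsertion.CombGauge

section Concrete

variable {P : Params} {j : ℕ} {G : Type*} [GaugeGroup G]

/-- Every site is its base plus its offsets, coordinatewise. [folklore] -/
theorem eq_base_add_offset (base x : Site P j) (k : Fin P.d) :
    x k = base k + (((x k - base k).val : ℕ) : ZMod (P.sitesPerDir j)) := by
  haveI : NeZero (P.sitesPerDir j) := ⟨by unfold Params.sitesPerDir; have := P.hL.2; positivity⟩
  rw [ZMod.natCast_zmod_val]; ring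

/-- The offset of `x.shift μ` in direction `μ` is one more (no wrap-around: `offset + 1 < N`). [folklore] -/
theorem offset_shift_self (base x : Site P j) (μ : Fin P.d) (h : (x μ - base μ).val + 1 < P.sitesPerDir j) :
    ((x.shift μ) μ - base μ).val = (x μ - base μ).val + 1 := by
  haveI : NeZero (P.sitesPerDir j) := ⟨by unfold Params.sitesPerDir; have := P.hL.2; positivity⟩
  rw [shift_eq_update, Function.update_self]
  have e : x μ + 1 - base μ = (x μ - base μ) + 1 := by ring
  rw [e]
  have h1 : (1 : ZMod (P.sitesPerDir j)).val = 1 := ZMod.val_one'' (by omega)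
  rw [ZMod.val_add_of_lt (by rw [h1]; exact h), h1]

/-- The offset of `x.shift μ` in a direction `ν ≠ μ` is unchanged. [folklore] -/
theorem offset_shift_of_ne (base x : Site P j) {μ ν : Fin P.d} (h : ν ≠ μ) :
    ((x.shift μ) ν - base ν).val = (x ν - base ν).val := by
  rw [shift_eq_update, Function.update_of_ne h]

/-- **THE COMB GAUGE OF A BOX (three lattice directions `μ₀ < μ₁ < μ₂` exhausting `Fin P.d`, i.e. `d = 3`).**  For every configuration `U`
and base point, there is a gauge transformation `g` (the complete axial «comb» gauge: holonomies along `e₀`, then `e₁`, then `e₂` from the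
base) such that for every bond `⟨x, μ⟩` whose endpoints have offsets `< n` from the base (`n + 1 ≤ N`, no wrap-around) the gauged bond
variable is within `dist1` of `1` by at most the sum of `dist1 U(∂p)` over the (at most `2n`) plaquettes of the two ladders hanging from
the bond — here bounded by the sum over ALL `t < n` of the three ladder families at the bond's foot points (`P₁ = base + o₀e₀`,
`P₂ = P₁ + o₁e₁`, plaquettes `⟨P₂ + te₂, μ₀, μ₂⟩`, `⟨P₁ + te₁, μ₀, μ₁⟩`, `⟨P₂ + te₂, μ₁, μ₂⟩`), a configuration-independent index set.
Non-abelian Stokes for ladders (`dist1_ladder_le`). [folklore] -/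
theorem exists_combGauge_dist1_le (U : GaugeField P j G) (base : Site P j) {μ₀ μ₁ μ₂ : Fin P.d}
    (h01 : μ₀ < μ₁) (h02 : μ₀ < μ₂) (h12 : μ₁ < μ₂) (hfull : ∀ k : Fin P.d, k = μ₀ ∨ k = μ₁ ∨ k = μ₂)
    (n : ℕ) (hnN : n + 1 ≤ P.sitesPerDir j) :
    ∃ g : GaugeTransf P j G, ∀ (x : Site P j) (μ : Fin P.d),
      (∀ k, (x k - base k).val < n) → ((x.shift μ) μ - base μ).val < n →
      dist1 (GaugeField.gaugeAct g U ⟨x, μ⟩) ≤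
        ∑ t ∈ Finset.range n,
          (dist1 (GaugeField.plaqHol U
              ⟨Function.update
                  (Function.update (Function.update base μ₀ (base μ₀ + (((x μ₀ - base μ₀).val : ℕ) : ZMod (P.sitesPerDir j)))) μ₁
                    ((Function.update base μ₀ (base μ₀ + (((x μ₀ - base μ₀).val : ℕ) : ZMod (P.sitesPerDir j)))) μ₁ +
                      (((x μ₁ - base μ₁).val : ℕ) : ZMod (P.sitesPerDir j))))
                  μ₂
                  ((Function.update (Function.update base μ₀ (base μ₀ + (((x μ₀ - base μ₀).val : ℕ) : ZMod (P.sitesPerDir j)))) μ₁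
                    ((Function.update base μ₀ (base μ₀ + (((x μ₀ - base μ₀).val : ℕ) : ZMod (P.sitesPerDir j)))) μ₁ +
                      (((x μ₁ - base μ₁).val : ℕ) : ZMod (P.sitesPerDir j)))) μ₂ + (t : ZMod (P.sitesPerDir j))),
                μ₀, μ₂, h02⟩) +
            dist1 (GaugeField.plaqHol U
              ⟨Function.update (Function.update base μ₀ (base μ₀ + (((x μ₀ - base μ₀).val : ℕ) : ZMod (P.sitesPerDir j)))) μ₁
                  ((Function.update base μ₀ (base μ₀ + (((x μ₀ - base μ₀).val : ℕ) : ZMod (P.sitesPerDir j)))) μ₁ +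
                    (t : ZMod (P.sitesPerDir j))),
                μ₀, μ₁, h01⟩) +
            dist1 (GaugeField.plaqHol U
              ⟨Function.update
                  (Function.update (Function.update base μ₀ (base μ₀ + (((x μ₀ - base μ₀).val : ℕ) : ZMod (P.sitesPerDir j)))) μ₁
                    ((Function.update base μ₀ (base μ₀ + (((x μ₀ - base μ₀).val : ℕ) : ZMod (P.sitesPerDir j)))) μ₁ +
                      (((x μ₁ - base μ₁).val : ℕ) : ZMod (P.sitesPerDir j))))
                  μ₂
                  ((Function.update (Function.update base μ₀ (base μ₀ + (((x μ₀ - base μ₀).val : ℕ) : ZMod (P.sitesPerDir j)))) μ₁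
                    ((Function.update base μ₀ (base μ₀ + (((x μ₀ - base μ₀).val : ℕ) : ZMod (P.sitesPerDir j)))) μ₁ +
                      (((x μ₁ - base μ₁).val : ℕ) : ZMod (P.sitesPerDir j)))) μ₂ + (t : ZMod (P.sitesPerDir j))),
                μ₁, μ₂, h12⟩)) := by
  have hne01 : μ₀ ≠ μ₁ := ne_of_lt h01
  have hne02 : μ₀ ≠ μ₂ := ne_of_lt h02
  have hne12 : μ₁ ≠ μ₂ := ne_of_lt h12
  -- straight-segment holonomies
  set H : Site P j → Fin P.d → ℕ → G := fun y μ t =>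
    ((List.range t).map (fun s : ℕ => U ⟨Function.update y μ (y μ + (s : ZMod (P.sitesPerDir j))), μ⟩)).prod with hH
  have hH0 : ∀ y μ, H y μ 0 = 1 := fun y μ => by simp [hH]
  have hHs : ∀ y μ t, H y μ (t + 1) = H y μ t * U ⟨Function.update y μ (y μ + (t : ZMod (P.sitesPerDir j))), μ⟩ :=
    fun y μ t => by simp only [hH]; exact List.prod_range_succ _ _
  -- offsets and foot points, as functions of the site
  set o : Fin P.d → Site P j → ℕ := fun μ y => (y μ - base μ).val with ho
  set P1 : Site P j → Site P j := fun y => Function.update base μ₀ (base μ₀ + ((o μ₀ y : ℕ) : ZMod (P.sitesPerDir j))) with hP1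
  set P2 : Site P j → Site P j := fun y => Function.update (P1 y) μ₁ ((P1 y) μ₁ + ((o μ₁ y : ℕ) : ZMod (P.sitesPerDir j))) with hP2
  -- the comb gauge
  refine ⟨fun y => H base μ₀ (o μ₀ y) * H (P1 y) μ₁ (o μ₁ y) * H (P2 y) μ₂ (o μ₂ y), fun x μ hx hxμ => ?_⟩
  set g : GaugeTransf P j G := fun y => H base μ₀ (o μ₀ y) * H (P1 y) μ₁ (o μ₁ y) * H (P2 y) μ₂ (o μ₂ y) with hg
  have hgdef : ∀ y, g y = H base μ₀ (o μ₀ y) * H (P1 y) μ₁ (o μ₁ y) * H (P2 y) μ₂ (o μ₂ y) := fun y => rfl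
  -- no wrap-around along `μ`
  have hwrap : (x μ - base μ).val + 1 < P.sitesPerDir j := by have := hx μ; omega
  have hoμ : o μ (x.shift μ) = o μ x + 1 := by simp only [ho]; exact offset_shift_self base x μ hwrap
  have hoν : ∀ ν, ν ≠ μ → o ν (x.shift μ) = o ν x := fun ν hν => by simp only [ho]; exact offset_shift_of_ne base x hν
  -- coordinates of the foot points
  have hP1v : ∀ k, P1 x k = if k = μ₀ then base μ₀ + ((o μ₀ x : ℕ) : ZMod (P.sitesPerDir j)) else base k := by
    intro k; simp only [hP1]; by_cases hk : k = μ₀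
    · subst hk; rw [if_pos rfl, Function.update_self]
    · rw [if_neg hk, Function.update_of_ne hk]
  have hP2v : ∀ k, P2 x k = if k = μ₁ then P1 x μ₁ + ((o μ₁ x : ℕ) : ZMod (P.sitesPerDir j)) else P1 x k := by
    intro k; simp only [hP2]; by_cases hk : k = μ₁
    · subst hk; rw [if_pos rfl, Function.update_self]
    · rw [if_neg hk, Function.update_of_ne hk]
  -- reconstruction of `x` from its foot point `P2 x` and its last offset
  have hrec : Function.update (P2 x) μ₂ ((P2 x) μ₂ + ((o μ₂ x : ℕ) : ZMod (P.sitesPerDir j))) = x := by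
    funext k
    rcases hfull k with h | h | h <;> rw [h]
    · rw [Function.update_of_ne hne02, hP2v, if_neg hne01, hP1v, if_pos rfl, ho]
      exact (eq_base_add_offset base x _).symm
    · rw [Function.update_of_ne hne12, hP2v, if_pos rfl, hP1v, if_neg (Ne.symm hne01), ho]
      exact (eq_base_add_offset base x _).symm
    · rw [Function.update_self, hP2v, if_neg (Ne.symm hne12), hP1v, if_neg (Ne.symm hne02), ho]
      exact (eq_base_add_offset base x _).symm
  -- every term of the right-hand side is non-negative
  have hRHS0 : ∀ t : ℕ, 0 ≤ dist1 (GaugeField.plaqHol U ⟨Function.update (P2 x) μ₂ ((P2 x) μ₂ + (t : ZMod (P.sitesPerDir j))), μ₀, μ₂, h02⟩) +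
      dist1 (GaugeField.plaqHol U ⟨Function.update (P1 x) μ₁ ((P1 x) μ₁ + (t : ZMod (P.sitesPerDir j))), μ₀, μ₁, h01⟩) +
      dist1 (GaugeField.plaqHol U ⟨Function.update (P2 x) μ₂ ((P2 x) μ₂ + (t : ZMod (P.sitesPerDir j))), μ₁, μ₂, h12⟩) :=
    fun t => add_nonneg (add_nonneg (GaugeGroup.dist1_nonneg _) (GaugeGroup.dist1_nonneg _)) (GaugeGroup.dist1_nonneg _)
  have ho₂n : o μ₂ x < n := hx μ₂
  have ho₁n : o μ₁ x < n := hx μ₁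
  show dist1 (GaugeField.gaugeAct g U ⟨x, μ⟩) ≤ ∑ t ∈ Finset.range n,
    (dist1 (GaugeField.plaqHol U ⟨Function.update (P2 x) μ₂ ((P2 x) μ₂ + (t : ZMod (P.sitesPerDir j))), μ₀, μ₂, h02⟩) +
      dist1 (GaugeField.plaqHol U ⟨Function.update (P1 x) μ₁ ((P1 x) μ₁ + (t : ZMod (P.sitesPerDir j))), μ₀, μ₁, h01⟩) +
      dist1 (GaugeField.plaqHol U ⟨Function.update (P2 x) μ₂ ((P2 x) μ₂ + (t : ZMod (P.sitesPerDir j))), μ₁, μ₂, h12⟩))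
  -- the three full ladder sums dominate
  have hS02 : ∑ t ∈ Finset.range (o μ₂ x), dist1 (GaugeField.plaqHol U
        ⟨Function.update (P2 x) μ₂ ((P2 x) μ₂ + (t : ZMod (P.sitesPerDir j))), μ₀, μ₂, h02⟩) ≤
      ∑ t ∈ Finset.range n, dist1 (GaugeField.plaqHol U
        ⟨Function.update (P2 x) μ₂ ((P2 x) μ₂ + (t : ZMod (P.sitesPerDir j))), μ₀, μ₂, h02⟩) :=
    Finset.sum_le_sum_of_subset_of_nonneg (Finset.range_subset_range.mpr ho₂n.le)
      (fun t _ _ => GaugeGroup.dist1_nonneg _)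
  have hS01 : ∑ t ∈ Finset.range (o μ₁ x), dist1 (GaugeField.plaqHol U
        ⟨Function.update (P1 x) μ₁ ((P1 x) μ₁ + (t : ZMod (P.sitesPerDir j))), μ₀, μ₁, h01⟩) ≤
      ∑ t ∈ Finset.range n, dist1 (GaugeField.plaqHol U
        ⟨Function.update (P1 x) μ₁ ((P1 x) μ₁ + (t : ZMod (P.sitesPerDir j))), μ₀, μ₁, h01⟩) :=
    Finset.sum_le_sum_of_subset_of_nonneg (Finset.range_subset_range.mpr ho₁n.le)
      (fun t _ _ => GaugeGroup.dist1_nonneg _)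
  have hS12 : ∑ t ∈ Finset.range (o μ₂ x), dist1 (GaugeField.plaqHol U
        ⟨Function.update (P2 x) μ₂ ((P2 x) μ₂ + (t : ZMod (P.sitesPerDir j))), μ₁, μ₂, h12⟩) ≤
      ∑ t ∈ Finset.range n, dist1 (GaugeField.plaqHol U
        ⟨Function.update (P2 x) μ₂ ((P2 x) μ₂ + (t : ZMod (P.sitesPerDir j))), μ₁, μ₂, h12⟩) :=
    Finset.sum_le_sum_of_subset_of_nonneg (Finset.range_subset_range.mpr ho₂n.le)
      (fun t _ _ => GaugeGroup.dist1_nonneg _)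
  have hT02 : 0 ≤ ∑ t ∈ Finset.range n, dist1 (GaugeField.plaqHol U
        ⟨Function.update (P2 x) μ₂ ((P2 x) μ₂ + (t : ZMod (P.sitesPerDir j))), μ₀, μ₂, h02⟩) :=
    Finset.sum_nonneg fun t _ => GaugeGroup.dist1_nonneg _
  have hT01 : 0 ≤ ∑ t ∈ Finset.range n, dist1 (GaugeField.plaqHol U
        ⟨Function.update (P1 x) μ₁ ((P1 x) μ₁ + (t : ZMod (P.sitesPerDir j))), μ₀, μ₁, h01⟩) :=
    Finset.sum_nonneg fun t _ => GaugeGroup.dist1_nonneg _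
  have hT12 : 0 ≤ ∑ t ∈ Finset.range n, dist1 (GaugeField.plaqHol U
        ⟨Function.update (P2 x) μ₂ ((P2 x) μ₂ + (t : ZMod (P.sitesPerDir j))), μ₁, μ₂, h12⟩) :=
    Finset.sum_nonneg fun t _ => GaugeGroup.dist1_nonneg _
  rw [Finset.sum_add_distrib, Finset.sum_add_distrib]
  -- the value of `g` at `x`, read at the reconstructed point
  have hgx : g (Function.update (P2 x) μ₂ ((P2 x) μ₂ + ((o μ₂ x : ℕ) : ZMod (P.sitesPerDir j)))) =
      H base μ₀ (o μ₀ x) * H (P1 x) μ₁ (o μ₁ x) * H (P2 x) μ₂ (o μ₂ x) := by rw [hrec]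
  have hfull' : μ₀ = μ ∨ μ₁ = μ ∨ μ₂ = μ := by
    rcases hfull μ with h | h | h
    · exact Or.inl h.symm
    · exact Or.inr (Or.inl h.symm)
    · exact Or.inr (Or.inr h.symm)
  rcases hfull' with rfl | rfl | rfl
  · -- bottom direction: two ladders
    have hP1s : P1 (x.shift μ₀) = (P1 x).shift μ₀ := by
      simp only [hP1]; rw [hoμ, ← shift_update_self]
    have hP2s : P2 (x.shift μ₀) = Site.shift (P2 x) μ₀ := by
      simp only [hP2]
      rw [hoν μ₁ (Ne.symm hne01), hP1s, shift_update_of_ne _ (Ne.symm hne01), shift_eq_update (P1 x) μ₀,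
        Function.update_of_ne (Ne.symm hne01)]
    have hpt : Function.update (Site.shift (P2 x) μ₀) μ₂ ((Site.shift (P2 x) μ₀) μ₂ + ((o μ₂ x : ℕ) : ZMod (P.sitesPerDir j))) =
        x.shift μ₀ := by
      conv_rhs => rw [← hrec]
      rw [shift_update_of_ne _ (Ne.symm hne02), shift_eq_update (P2 x) μ₀, Function.update_of_ne (Ne.symm hne02)]
    have hgx' : g (Function.update (Site.shift (P2 x) μ₀) μ₂ ((Site.shift (P2 x) μ₀) μ₂ + ((o μ₂ x : ℕ) : ZMod (P.sitesPerDir j)))) =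
        H base μ₀ (o μ₀ x) * U ⟨P1 x, μ₀⟩ * H ((P1 x).shift μ₀) μ₁ (o μ₁ x) * H (Site.shift (P2 x) μ₀) μ₂ (o μ₂ x) := by
      rw [hpt, hgdef, hoμ, hoν μ₁ (Ne.symm hne01), hoν μ₂ (Ne.symm hne02), hP1s, hP2s, hHs]
    have hb := dist1_gaugeAct_comb_bot U H hH0 hHs g (P1 x) h01 h02 (H base μ₀ (o μ₀ x)) (o μ₁ x) (o μ₂ x) hgx hgx'
    rw [hrec] at hb
    linarith
  · -- middle direction: one ladder
    have hP1s : P1 (x.shift μ₁) = P1 x := by simp only [hP1]; rw [hoν μ₀ hne01]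
    have hP2s : P2 (x.shift μ₁) = Site.shift (P2 x) μ₁ := by
      simp only [hP2]; rw [hP1s, hoμ, ← shift_update_self]
    have hpt : Function.update (Site.shift (P2 x) μ₁) μ₂ ((Site.shift (P2 x) μ₁) μ₂ + ((o μ₂ x : ℕ) : ZMod (P.sitesPerDir j))) =
        x.shift μ₁ := by
      conv_rhs => rw [← hrec]
      rw [shift_update_of_ne _ (Ne.symm hne12), shift_eq_update (P2 x) μ₁, Function.update_of_ne (Ne.symm hne12)]
    have hgx' : g (Function.update (Site.shift (P2 x) μ₁) μ₂ ((Site.shift (P2 x) μ₁) μ₂ + ((o μ₂ x : ℕ) : ZMod (P.sitesPerDir j)))) =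
        H base μ₀ (o μ₀ x) * H (P1 x) μ₁ (o μ₁ x) * U ⟨P2 x, μ₁⟩ * H (Site.shift (P2 x) μ₁) μ₂ (o μ₂ x) := by
      rw [hpt, hgdef, hoμ, hoν μ₀ hne01, hoν μ₂ (Ne.symm hne12), hP1s, hP2s, hHs]
      simp only [hP2, mul_assoc]
    have hb := dist1_gaugeAct_comb_mid U H hH0 hHs g (P2 x) h12 (H base μ₀ (o μ₀ x) * H (P1 x) μ₁ (o μ₁ x)) (o μ₂ x) hgx hgx'
    rw [hrec] at hb
    linarith
  · -- top direction: the gauged bond is trivial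
    have hP1s : P1 (x.shift μ₂) = P1 x := by simp only [hP1]; rw [hoν μ₀ hne02]
    have hP2s : P2 (x.shift μ₂) = P2 x := by simp only [hP2]; rw [hP1s, hoν μ₁ hne12]
    have hpt : Function.update (P2 x) μ₂ ((P2 x) μ₂ + (((o μ₂ x) + 1 : ℕ) : ZMod (P.sitesPerDir j))) = x.shift μ₂ := by
      conv_rhs => rw [← hrec]
      rw [shift_update_self]
    have hgx1 : g (Function.update (P2 x) μ₂ ((P2 x) μ₂ + (((o μ₂ x) + 1 : ℕ) : ZMod (P.sitesPerDir j)))) =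
        H base μ₀ (o μ₀ x) * H (P1 x) μ₁ (o μ₁ x) * H (P2 x) μ₂ ((o μ₂ x) + 1) := by
      rw [hpt, hgdef, hoμ, hoν μ₀ hne02, hoν μ₁ hne12, hP1s, hP2s]
    have hb := gaugeAct_comb_top U H hHs g (P2 x) μ₂ (H base μ₀ (o μ₀ x) * H (P1 x) μ₁ (o μ₁ x)) (o μ₂ x) hgx hgx1
    rw [hrec] at hb
    rw [hb, GaugeGroup.dist1_one]
    linarith

end Concrete

end Summit.QuantumFields.YangMills.Theorems.LocalInsertion.CombGauge

/-! ## §2 Cell-level helpers -/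

namespace Summit.QuantumFields.YangMills.Theorems.LocalInsertion.MedianHeightOne

open MeasureTheory
open Literature.MathematicalPhysics.QuantumFieldTheory.Balaban1983to89.T3ContinuumYM3Torus
open Literature.MathematicalPhysics.QuantumFieldTheory.Balaban1983to89.T3UnitScaleTilt
open Literature.MathematicalPhysics.QuantumFieldTheory.Balaban1983to89.T3UnitLawDensityEML


/-- The three lattice directions of the cell's `d = 3` families exhaust `Fin (F.P K).d`. [folklore] -/
theorem dir_cases (F : T3Family) (K : ℕ) (k : Fin (F.P K).d) :
    k = ⟨0, by show 0 < 3; norm_num⟩ ∨ k = ⟨1, by show 1 < 3; norm_num⟩ ∨ k = ⟨2, by show 2 < 3; norm_num⟩ := by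
  rcases k with ⟨v, hv⟩
  have hv3 : v < 3 := hv
  interval_cases v
  · exact Or.inl rfl
  · exact Or.inr (Or.inl rfl)
  · exact Or.inr (Or.inr rfl)

/-- The iterated block average of the trivial configuration is trivial. [cite: Balaban1987RG1, (0.4) p.253] -/
theorem iter_blockAvg_one (F : T3Family) (K i : ℕ) :
    Averaging.iter (fun i' => BlockAveraging.blockAvg (P := F.P K) (j := i') ℰp) i
      (1 : GaugeField (F.P K) 0 (Matrix.specialUnitaryGroup (Fin 2) ℂ)) = 1 := by
  induction i with
  | zero => rfl
  | succ i ih =>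
    show (BlockAveraging.blockAvg ℰp).avg (Averaging.iter (fun i' => BlockAveraging.blockAvg (P := F.P K) (j := i') ℰp) i 1) = 1
    rw [ih, BlockAveraging.blockAvg_avg, T3DescentFibreTower.avgFun_one ℰp T3DescentFibreTower.expMeanLogSU_E_one]

/-- `17L + 1 ≤ 2L^{m+K}` sites per direction for `K ≥ 3` (`L ≥ 3`, `m ≥ 1`): the `17L`-box does not wrap. [folklore] -/
theorem box_fits (F : T3Family) {K : ℕ} (hK : 3 ≤ K) : 17 * F.L + 1 ≤ (F.P K).sitesPerDir 0 := by
  have hL3 : 3 ≤ F.L := by obtain ⟨k, hk⟩ := F.hL.1; have := F.hL.2; omega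
  have hN0 : (F.P K).sitesPerDir 0 = 2 * F.L ^ (F.m + K) := by simp [Params.sitesPerDir]
  rw [hN0]
  have hsplit : F.L ^ (F.m + K) = F.L * F.L ^ (F.m + K - 1) := by
    rw [← pow_succ']; congr 1; have := F.hm; omega
  have h9 : 9 ≤ F.L ^ (F.m + K - 1) :=
    calc 9 = 3 ^ 2 := by norm_num
      _ ≤ F.L ^ 2 := Nat.pow_le_pow_left hL3 2
      _ ≤ F.L ^ (F.m + K - 1) := Nat.pow_le_pow_right (by omega) (by have := F.hm; omega)
  rw [hsplit]
  nlinarith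


open Literature.MathematicalPhysics.QuantumFieldTheory.Balaban1983to89.T3MinimiserStabilityReduction (θBal_pos)
open Summit.QuantumFields.YangMills.Theorems.PoincareLipschitz.TwoSidedOfConcentration (dist1_plaqHol_iter_gaugeAct)

/-- `ℓ² ≤ ℓ¹` for non-negative families: `√(Σ f²) ≤ Σ f`. [folklore] -/
theorem sqrt_sum_sq_le_sum {ι : Type*} (s : Finset ι) (f : ι → ℝ) (hf : ∀ i, 0 ≤ f i) :
    Real.sqrt (∑ i ∈ s, f i ^ 2) ≤ ∑ i ∈ s, f i := by
  have hS : 0 ≤ ∑ i ∈ s, f i := Finset.sum_nonneg fun i _ => hf i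
  rw [Real.sqrt_le_left hS, sq, Finset.sum_mul]
  refine Finset.sum_le_sum fun i hi => ?_
  rw [sq]
  exact mul_le_mul_of_nonneg_left (Finset.single_le_sum (fun k _ => hf k) hi) (hf i)

/-- The number of bonds of the level-0 lattice whose source has all three offsets `< n` from a base point is at most `3·n³` (`n ≤ N`: the
offsets determine the source). [folklore] -/
theorem card_filter_offsets_lt_le (F : T3Family) (K : ℕ) (base : Site (F.P K) 0) (n : ℕ) :
    (((Finset.univ : Finset (PBond (F.P K) 0)).filter (fun b => ∀ k, (b.src k - base k).val < n)).card : ℝ) ≤ 3 * (n : ℝ) ^ 3 := by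
  classical
  haveI : NeZero ((F.P K).sitesPerDir 0) := ⟨by unfold Params.sitesPerDir; have := (F.P K).hL.2; positivity⟩
  set S := (Finset.univ : Finset (PBond (F.P K) 0)).filter (fun b => ∀ k, (b.src k - base k).val < n) with hS
  -- the offset map into `(Fin d → Fin n) × Fin d`
  let φ : PBond (F.P K) 0 → (Fin (F.P K).d → Fin (n + 1)) × Fin (F.P K).d := fun b =>
    (fun k => ⟨min ((b.src k - base k).val) n, by omega⟩, b.dir)
  have hinj : Set.InjOn φ S := by
    intro b hb b' hb' h
    simp only [hS, Finset.coe_filter, Finset.mem_univ, true_and, Set.mem_setOf_eq] at hb hb'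
    have h1 := congrArg Prod.fst h
    have h2 : b.dir = b'.dir := congrArg Prod.snd h
    have hsrc : b.src = b'.src := by
      funext k
      have hk := congrFun h1 k
      simp only [φ, Fin.mk.injEq, min_eq_left (hb k).le, min_eq_left (hb' k).le] at hk
      have e1 := ZMod.natCast_zmod_val (b.src k - base k)
      have e2 := ZMod.natCast_zmod_val (b'.src k - base k)
      rw [hk] at e1
      have : b.src k - base k = b'.src k - base k := e1.symm.trans e2
      calc b.src k = (b.src k - base k) + base k := by ring
        _ = (b'.src k - base k) + base k := by rw [this]
        _ = b'.src k := by ring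
    cases b; cases b'; simp only at hsrc h2; simp [hsrc, h2]
  -- the image lies in the `n`-part
  have himg : ∀ b ∈ S, φ b ∈ (Finset.univ.filter (fun q : (Fin (F.P K).d → Fin (n + 1)) × Fin (F.P K).d => ∀ k, (q.1 k : ℕ) < n)) := by
    intro b hb
    simp only [hS, Finset.mem_filter, Finset.mem_univ, true_and] at hb
    simp only [Finset.mem_filter, Finset.mem_univ, true_and, φ]
    intro k; exact lt_of_le_of_lt (min_le_left _ _) (hb k)
  have hcard := Finset.card_le_card_of_injOn φ himg hinj
  -- the `n`-part has `n³·3` elements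
  have hT : (Finset.univ.filter (fun q : (Fin (F.P K).d → Fin (n + 1)) × Fin (F.P K).d => ∀ k, (q.1 k : ℕ) < n)).card ≤ n ^ 3 * 3 := by
    let ψ : (Fin (F.P K).d → Fin n) × Fin (F.P K).d → (Fin (F.P K).d → Fin (n + 1)) × Fin (F.P K).d :=
      fun q => (fun k => ⟨q.1 k, by omega⟩, q.2)
    have hsub : (Finset.univ.filter (fun q : (Fin (F.P K).d → Fin (n + 1)) × Fin (F.P K).d => ∀ k, (q.1 k : ℕ) < n)) ⊆
        Finset.univ.image ψ := by
      intro q hq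
      simp only [Finset.mem_filter, Finset.mem_univ, true_and] at hq
      refine Finset.mem_image.mpr ⟨(fun k => ⟨q.1 k, hq k⟩, q.2), Finset.mem_univ _, ?_⟩
      cases q; simp [ψ]
    calc _ ≤ (Finset.univ.image ψ).card := Finset.card_le_card hsub
      _ ≤ (Finset.univ : Finset ((Fin (F.P K).d → Fin n) × Fin (F.P K).d)).card := Finset.card_image_le
      _ = n ^ 3 * 3 := by
          rw [Finset.card_univ, Fintype.card_prod, Fintype.card_fun, Fintype.card_fin, Fintype.card_fin]
          show n ^ 3 * 3 = n ^ 3 * 3; rfl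
  have : (S.card : ℝ) ≤ ((n ^ 3 * 3 : ℕ) : ℝ) := by exact_mod_cast hcard.trans hT
  calc (S.card : ℝ) ≤ ((n ^ 3 * 3 : ℕ) : ℝ) := this
    _ = 3 * (n : ℝ) ^ 3 := by push_cast; ring

end Summit.QuantumFields.YangMills.Theorems.LocalInsertion.MedianHeightOne
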